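import Summits.BirchSwinnertonDyer.BirchSwinnertonDyer.Theorems.AlignedTransportAtTwoMainConjectureTransportAlignedAtTwoBothAddCongruence
import Literature.NumberTheory.EllipticCurves.PAdicLFunctionQuadraticTwistCongruenceAtTwoSharedPrimesProofs
import Literature.NumberTheory.EllipticCurves.RootNumberTwistProofs
import HarnessLib

/-!
# Route `AlignedTransportAtTwo`, crux C1 (stmt-BirchSwinnertonDyer-22296), line `birth` — BOTH-ADDITIVE twist leg, part 4 (BIRCH):
# `aₙ(E^{(d)}) = χ_d(n)aₙ(E)`, `N_E ∣ N_{E^{(d)}}`, `d² ∣ N_{E^{(d)}}`, `f_A = (f_W)_χ`, Birch's lemma with the period identity and the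
# transform identity, when `E^{(d)}` is ADDITIVE at every prime of `d` and those primes are `≥ 5` (no semistability of `E` at `d`)

HONEST FRAMING (cell `bsd-f1-sign2`, lead seat `bsd-line-att-p1` g8). BSD is NOT proved; C1 is NOT closed. THEOREMS ONLY; nothing asserted;
`--supports stmt-BirchSwinnertonDyer-22296 --as helper`. The tree's Birch files (`…BirchSharedPrimesProofs`, `…CongruenceAtTwoSharedPrimesProofs`)
assume `E` good or multiplicative at the primes of `d`, using it only for (i) `E^{(d)}` additive there and (ii) `f_v(E) ≤ 1 < 2 ≤ f_v(E^{(d)})`; both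
hold when `E^{(d)}` is additive at `v` and `ℓ_v ≥ 5` (`f_ℓ(E) ≤ 2`, `conductorExponent_le_two_of_five_le_natGenerator_holds`). This file re-runs
those proofs under `hadd : ∀ v ∣ d, 5 ≤ ℓ_v ∧ E^{(d)} additive at v`.

References: [MazurTateTeitelbaum1986Invent] §I.8, §I.11; [Shimura1971] Prop. 3.64; [AtkinLehner1970] §6; [SilvermanAEC2009] App. C §16, VII.5;
[SilvermanATAEC1994] IV.10.2.
-/

set_option autoImplicit false
set_option linter.dupNamespace false

noncomputable section

open scoped Classical MatrixGroups ModularForm NumberTheorySymbols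

open Filter CongruenceSubgroup NumberField IsDedekindDomain IsDedekindDomain.HeightOneSpectrum Rat.HeightOneSpectrum
  WeierstrassCurve PowerSeries Literature.NumberTheory.EllipticCurves Literature.NumberTheory.EllipticCurves.ModularForms
  Literature.NumberTheory.EllipticCurves.GreenbergVatsal2000
open Summit.BirchSwinnertonDyer.BirchSwinnertonDyer.Theorems.AlignedTransportAtTwoBothAddCongruence

namespace Summit.BirchSwinnertonDyer.BirchSwinnertonDyer.Theorems.AlignedTransportAtTwoBothAddBirch

variable (W : WeierstrassCurve ℚ) [W.IsElliptic]

/-! ## §1 `aₙ(E^{(d)}) = χ_d(n)·aₙ(E)` when `E^{(d)}` is additive at the primes of `d` -/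

/-- **`aₙ(E^{(D)}) = (n / |D|) aₙ(E)`** (`D ≡ 1 (mod 4)`) when `E^{(D)}` is ADDITIVE at every place over `D` (there `L_v(E^{(D)}, T) = 1 = χ_D(ℓ)·…`);
the tree's `LFunction_quadraticTwist_apply_of_isGloballyMinimal_sqfreeAt` verbatim otherwise. [cite: SilvermanAEC2009, X.2 and Exercise 10.16] -/
theorem LFunction_quadraticTwist_apply_of_addv [W.IsGloballyMinimal] {D : ℤ} (hD4 : D % 4 = 1)
    (hadd : ∀ v : HeightOneSpectrum (𝓞 ℚ), ((primesEquiv v : ℕ) : ℤ) ∣ D →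
      (haveI := W.isElliptic_quadraticTwist (show ((D : ℚ)) ≠ 0 by exact_mod_cast (show D ≠ 0 by omega));
        (W.quadraticTwist (D : ℚ)).HasAdditiveReductionAt v))
    (n : ℕ) :
    (W.quadraticTwist (D : ℚ)).LFunction n = J((n : ℤ) | D.natAbs) * W.LFunction n := by
  have hD0 : D ≠ 0 := by rintro rfl; norm_num at hD4
  have hDq : (D : ℚ) ≠ 0 := by exact_mod_cast hD0
  haveI : (W.quadraticTwist (D : ℚ)).IsElliptic := W.isElliptic_quadraticTwist hDq
  rw [LFunction_eq_eulerProduct, LFunction_eq_eulerProduct]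
  refine ArithmeticFunction.eulerProduct_apply_eq_mul_of_forall (P := fun _ ↦ True)
    (fun _ _ _ ↦ ⟨trivial, trivial⟩) (fun n : ℕ ↦ J((n : ℤ) | D.natAbs))
    (by exact_mod_cast jacobiSym.one_left D.natAbs)
    (fun m n ↦ by push_cast; exact jacobiSym.mul_left _ _ _) _ _ (fun v m _ ↦ ?_)
    (eventually_cofinite_localEulerFactor_apply _) (eventually_cofinite_localEulerFactor_apply _) trivial
  haveI := Fact.mk (primesEquiv v).2
  have hℓ1 : 1 < (primesEquiv v : ℕ) := (primesEquiv v).2.one_lt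
  by_cases hvD : ((primesEquiv v : ℕ) : ℤ) ∣ D
  · -- ramified place: the factor of the twist is trivial and `χ_D(ℓ) = 0`
    have hadd' := hadd v hvD
    haveI : NeZero D.natAbs := ⟨Int.natAbs_ne_zero.mpr hD0⟩
    have hJ0 : J(((primesEquiv v : ℕ) : ℤ) | D.natAbs) = 0 := by
      rw [jacobiSym.eq_zero_iff_not_coprime, Int.gcd_natCast_natCast]
      intro hcop
      have hdvd : (primesEquiv v : ℕ) ∣ D.natAbs := Int.natCast_dvd.mp hvD
      exact (primesEquiv v).2.one_lt.ne' (Nat.Coprime.eq_one_of_dvd hcop hdvd)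
    rw [localEulerFactor_eq_one_of_hasAdditiveReduction _ hadd', ArithmeticFunction.one_apply]
    split_ifs with hm1
    · rw [hm1, localEulerFactor_apply_one, Nat.cast_one, jacobiSym.one_left, one_mul]
    · by_cases hpow : ∃ k, Nat.card (IsLocalRing.ResidueField (v.adicCompletionIntegers ℚ)) ^ k = m
      · obtain ⟨k, rfl⟩ := hpow
        rw [natCard_residueField_adicCompletionIntegers] at hm1 ⊢
        have hk : k ≠ 0 := fun h ↦ hm1 (by rw [h, pow_zero])
        rw [Nat.cast_pow, jacobiSym.pow_left, hJ0, zero_pow hk, zero_mul]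
      · rw [localEulerFactor_apply_eq_zero _ _ (by rwa [natCard_residueField_adicCompletionIntegers]) hpow,
          mul_zero]
  · -- unramified place
    have key : ((W.quadraticTwist (D : ℚ)).baseChange (v.adicCompletion ℚ)).localEulerFactor
        (v.adicCompletionIntegers ℚ) =
        ArithmeticFunction.ofPowerSeries (primesEquiv v : ℕ)
          (PowerSeries.rescale (J(((primesEquiv v : ℕ) : ℤ) | D.natAbs))
            ((W.baseChange (v.adicCompletion ℚ)).localPowerSeries (v.adicCompletionIntegers ℚ))) := by
      by_cases hv2 : (primesEquiv v : ℕ) = 2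
      · exact W.localEulerFactor_quadraticTwist_two_of_emod_four_eq_one hD4 v hv2
      · exact W.localEulerFactor_quadraticTwist_of_odd_of_not_dvd hD4 v hv2 hvD
    rw [key, localEulerFactor, natCard_residueField_adicCompletionIntegers]
    exact ArithmeticFunction.ofPowerSeries_rescale_apply hℓ1 (fun n : ℕ ↦ J((n : ℤ) | D.natAbs))
      (by exact_mod_cast jacobiSym.one_left D.natAbs)
      (fun m n ↦ by push_cast; exact jacobiSym.mul_left _ _ _) _ m

/-! ## §2 `N_E ∣ N_{E^{(d)}}`, `d² ∣ N_{E^{(d)}}` when `E^{(d)}` is additive at the primes `≥ 5` of `d` -/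

/-- **`N_E ∣ N_{E^{(d)}}`, `d² ∣ N_{E^{(d)}}`, `2 ∤ N_E ⇒ 2 ∤ N_{E^{(d)}}`** when at every place over `d` the prime is `≥ 5` and `E^{(d)}` is additive
(`f_v(E) ≤ 2 ≤ f_v(E^{(d)})`; off `d` the exponents agree). [cite: SilvermanAEC2009, App. C §16 (PDF pp. 390–391)] [cite: SilvermanATAEC1994, Thm. IV.10.2] -/
theorem conductorNorm_dvd_and_sq_dvd_conductorNorm_quadraticTwist_of_addv {d : ℤ} (hd4 : d % 4 = 1) (hsq : Squarefree d)
    (hadd : ∀ v : HeightOneSpectrum ℤ, ((natGenerator v : ℕ) : ℤ) ∣ d →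
      5 ≤ (natGenerator v : ℕ) ∧
      (haveI := W.isElliptic_quadraticTwist (show ((d : ℚ)) ≠ 0 by exact_mod_cast (show d ≠ 0 by omega));
        (W.quadraticTwist (d : ℚ)).HasAdditiveReductionAt v)) :
    (haveI := W.isElliptic_quadraticTwist (show ((d : ℚ)) ≠ 0 by exact_mod_cast (show d ≠ 0 by omega));
      W.conductorNorm ℤ ∣ (W.quadraticTwist (d : ℚ)).conductorNorm ℤ ∧
        d.natAbs ^ 2 ∣ (W.quadraticTwist (d : ℚ)).conductorNorm ℤ ∧
        (¬ 2 ∣ W.conductorNorm ℤ → ¬ 2 ∣ (W.quadraticTwist (d : ℚ)).conductorNorm ℤ)) := by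
  have hd0 : d ≠ 0 := by omega
  have hdq : (d : ℚ) ≠ 0 := by exact_mod_cast hd0
  haveI := W.isElliptic_quadraticTwist hdq
  set N := W.conductorNorm ℤ with hN
  set N' := (W.quadraticTwist (d : ℚ)).conductorNorm ℤ with hN'
  have hN0 : N ≠ 0 := (W.conductorNorm_pos_holds).ne'
  have hN'0 : N' ≠ 0 := ((W.quadraticTwist (d : ℚ)).conductorNorm_pos_holds).ne'
  have hgen : ∀ q : Nat.Primes, natGenerator ((primesEquiv (R := ℤ)).symm q) = q := fun q ↦
    congrArg (fun q : Nat.Primes ↦ (q : ℕ)) ((primesEquiv (R := ℤ)).apply_symm_apply q)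
  have hle : ∀ q : ℕ, q.Prime → N.factorization q ≤ N'.factorization q ∧
      (((q : ℤ) ∣ d) → 2 ≤ N'.factorization q) := by
    intro q hq
    set vq : HeightOneSpectrum ℤ := (primesEquiv (R := ℤ)).symm ⟨q, hq⟩ with hvq
    have hgenq : natGenerator vq = q := by rw [hvq]; exact hgen ⟨q, hq⟩
    by_cases hqd : (q : ℤ) ∣ d
    · obtain ⟨h5, haddv⟩ := hadd vq (by rw [hgenq]; exact hqd)
      have hfW : N.factorization q = W.conductorExponent vq := by
        rw [← hgenq]; exact factorization_conductorNorm_holds W vq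
      have hfA : N'.factorization q = (W.quadraticTwist (d : ℚ)).conductorExponent vq := by
        rw [← hgenq]; exact factorization_conductorNorm_holds _ vq
      have h1 : W.conductorExponent vq ≤ 2 := W.conductorExponent_le_two_of_five_le_natGenerator_holds vq h5
      have h2 : 2 ≤ (W.quadraticTwist (d : ℚ)).conductorExponent vq :=
        (two_le_conductorExponent_iff_holds vq (W.quadraticTwist (d : ℚ))).mpr haddv
      rw [hfW, hfA]
      exact ⟨h1.trans h2, fun _ ↦ h2⟩
    · have h := W.factorization_conductorNorm_quadraticTwist_eq_of_not_dvd hd4 vq (by rw [hgenq]; exact hqd)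
      rw [hgenq] at h
      exact ⟨h.symm.le, fun h' ↦ absurd h' hqd⟩
  refine ⟨?_, ?_, ?_⟩
  · refine (Nat.factorization_le_iff_dvd hN0 hN'0).mp (Finsupp.le_def.mpr fun q ↦ ?_)
    by_cases hq : q.Prime
    · exact (hle q hq).1
    · rw [Nat.factorization_eq_zero_of_not_prime _ hq]; exact Nat.zero_le _
  · have hda : d.natAbs ≠ 0 := Int.natAbs_ne_zero.mpr hd0
    refine (Nat.factorization_le_iff_dvd (pow_ne_zero 2 hda) hN'0).mp (Finsupp.le_def.mpr fun q ↦ ?_)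
    rw [Nat.factorization_pow, Finsupp.smul_apply, smul_eq_mul]
    by_cases hq : q.Prime
    · by_cases hqd : (q : ℤ) ∣ d
      · have hsq1 : d.natAbs.factorization q ≤ 1 :=
          Nat.squarefree_iff_factorization_le_one hda |>.mp (Int.squarefree_natAbs.mpr hsq) q
        calc 2 * d.natAbs.factorization q ≤ 2 * 1 := by gcongr
          _ ≤ N'.factorization q := by rw [mul_one]; exact (hle q hq).2 hqd
      · have h0 : d.natAbs.factorization q = 0 :=
          Nat.factorization_eq_zero_of_not_dvd fun h ↦ hqd (Int.natCast_dvd.mpr h)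
        rw [h0, mul_zero]; exact Nat.zero_le _
    · rw [Nat.factorization_eq_zero_of_not_prime _ hq, mul_zero]; exact Nat.zero_le _
  · intro h2N h2N'
    have h2d : ¬ ((2 : ℕ) : ℤ) ∣ d := by intro h; omega
    set v2 : HeightOneSpectrum ℤ := (primesEquiv (R := ℤ)).symm ⟨2, Nat.prime_two⟩ with hv2
    have hgen2 : natGenerator v2 = 2 := by rw [hv2]; exact hgen ⟨2, Nat.prime_two⟩
    have h := W.factorization_conductorNorm_quadraticTwist_eq_of_not_dvd hd4 v2 (by rw [hgen2]; exact h2d)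
    rw [hgen2] at h
    have hpos : 0 < N'.factorization 2 := Nat.Prime.factorization_pos_of_dvd Nat.prime_two hN'0 h2N'
    rw [h] at hpos
    exact h2N (Nat.dvd_of_factorization_pos (Nat.pos_iff_ne_zero.mp hpos))

/-! ## §3 The pair `(f_W, f_A)`: conductor, `f_A = (f_W)_χ`, Birch's lemma with the period identity -/

section Pair

variable [W.IsGloballyMinimal] {d : ℤ} {A : WeierstrassCurve ℚ} [A.IsElliptic]

omit [W.IsGloballyMinimal] [A.IsElliptic] in
/-- The twist model `W^{(d)}` is additive at every place over `d` when a model `A` of it is (additivity is an isomorphism invariant,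
`hasAdditiveReductionAt_smul_iff_holds`). [cite: SilvermanAEC2009, VII.5 Prop. 5.1] -/
theorem hasAdditiveReductionAt_quadraticTwist_of_model (hd0 : d ≠ 0) {C : VariableChange ℚ} (hA : C • W.quadraticTwist (d : ℚ) = A)
    {v : HeightOneSpectrum (𝓞 ℚ)} (h : A.HasAdditiveReductionAt v) :
    (haveI := W.isElliptic_quadraticTwist (show ((d : ℚ)) ≠ 0 by exact_mod_cast hd0);
      (W.quadraticTwist (d : ℚ)).HasAdditiveReductionAt v) := by
  haveI := W.isElliptic_quadraticTwist (show ((d : ℚ)) ≠ 0 by exact_mod_cast hd0)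
  rw [← hA] at h
  exact (hasAdditiveReductionAt_smul_iff_holds v (W.quadraticTwist (d : ℚ)) C).mp h

omit [W.IsGloballyMinimal] [A.IsElliptic] in
/-- **`N_W ∣ N_A`, `d² ∣ N_A`, `2 ∤ N_W ⇒ 2 ∤ N_A`** for a model `A` of `W^{(d)}` ADDITIVE at the places over `d`, all of residue characteristic `≥ 5`
(§2 + `conductorNorm_smul`). [cite: SilvermanAEC2009, App. C §16] [cite: AtkinLehner1970, §6] -/
theorem conductorNorm_twist_dvd_addv (hd4 : d % 4 = 1) (hsq : Squarefree d)
    (hadd : ∀ v : HeightOneSpectrum (𝓞 ℚ), ((primesEquiv v : ℕ) : ℤ) ∣ d →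
      5 ≤ (primesEquiv v : ℕ) ∧ A.HasAdditiveReductionAt v)
    {C : VariableChange ℚ} (hA : C • W.quadraticTwist (d : ℚ) = A) :
    W.conductorNorm ℤ ∣ A.conductorNorm ℤ ∧ d.natAbs ^ 2 ∣ A.conductorNorm ℤ ∧
      (¬ 2 ∣ W.conductorNorm ℤ → ¬ 2 ∣ A.conductorNorm ℤ) := by
  have hd0 : d ≠ 0 := by omega
  have hdq : (d : ℚ) ≠ 0 := by exact_mod_cast hd0
  haveI := W.isElliptic_quadraticTwist hdq
  have hNA : A.conductorNorm ℤ = (W.quadraticTwist (d : ℚ)).conductorNorm ℤ := by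
    rw [← hA]; exact WeierstrassCurve.conductorNorm_smul ℤ _ C
  rw [hNA]
  refine conductorNorm_dvd_and_sq_dvd_conductorNorm_quadraticTwist_of_addv W hd4 hsq fun v hvd ↦ ?_
  -- move to the `𝓞 ℚ`-place over the same prime
  obtain ⟨p, rfl⟩ := (primesEquiv (R := ℤ)).symm.surjective v
  obtain ⟨w, hw⟩ : ∃ w : HeightOneSpectrum (𝓞 ℚ), primesEquiv w = p :=
    ⟨(primesEquiv (R := 𝓞 ℚ)).symm p, Equiv.apply_symm_apply _ _⟩
  subst hw
  have hgen : (natGenerator ((primesEquiv (R := ℤ)).symm (primesEquiv w)) : ℕ) = (primesEquiv w : ℕ) :=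
    congrArg (fun q : Nat.Primes ↦ (q : ℕ)) ((primesEquiv (R := ℤ)).apply_symm_apply _)
  have hww : (primesEquiv (R := 𝓞 ℚ)).symm (primesEquiv w) = w := Equiv.symm_apply_apply _ w
  rw [hgen] at hvd ⊢
  obtain ⟨h5, haddA⟩ := hadd w hvd
  refine ⟨h5, ?_⟩
  have h := (W.quadraticTwist (d : ℚ)).hasAdditiveReductionAt_int_iff_ringOfIntegers (primesEquiv w)
  rw [hww] at h
  exact h.mpr (hasAdditiveReductionAt_quadraticTwist_of_model W hd0 hA haddA)

omit [A.IsElliptic] in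
/-- **`aₙ(A) = χ_d(n)·aₙ(W)`** for a model `A` of `W^{(d)}` additive at the places over `d`. [cite: SilvermanAEC2009, X.2 and Exercise 10.16] -/
theorem LFunction_twist_apply_addv (hd4 : d % 4 = 1)
    (hadd : ∀ v : HeightOneSpectrum (𝓞 ℚ), ((primesEquiv v : ℕ) : ℤ) ∣ d →
      5 ≤ (primesEquiv v : ℕ) ∧ A.HasAdditiveReductionAt v)
    {C : VariableChange ℚ} (hA : C • W.quadraticTwist (d : ℚ) = A) (n : ℕ) :
    A.LFunction n = J((n : ℤ) | d.natAbs) * W.LFunction n := by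
  have hd0 : d ≠ 0 := by omega
  have hdq : (d : ℚ) ≠ 0 := by exact_mod_cast hd0
  haveI := W.isElliptic_quadraticTwist hdq
  rw [← hA, LFunction_smul]
  exact LFunction_quadraticTwist_apply_of_addv W hd4 (fun v hv ↦ hasAdditiveReductionAt_quadraticTwist_of_model W hd0 hA (hadd v hv).2) n

variable [NeZero (W.conductorNorm ℤ)] [NeZero (A.conductorNorm ℤ)] [NeZero d.natAbs]
  {fW : CuspForm (Gamma0 (W.conductorNorm ℤ)) 2} {fA : CuspForm (Gamma0 (A.conductorNorm ℤ)) 2}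

omit [A.IsElliptic] in
/-- **`f_A = (f_W)_χ` at level `N_A`** (same `q`-expansions), `A` additive at the places over `d`. [cite: Shimura1971, Prop. 3.64] -/
theorem isNewformOf_twist_eq_charTwist_addv (hd4 : d % 4 = 1)
    (hadd : ∀ v : HeightOneSpectrum (𝓞 ℚ), ((primesEquiv v : ℕ) : ℤ) ∣ d →
      5 ≤ (primesEquiv v : ℕ) ∧ A.HasAdditiveReductionAt v)
    {C : VariableChange ℚ} (hA : C • W.quadraticTwist (d : ℚ) = A)
    (hfW : IsNewformOf W fW) (hfA : IsNewformOf A fA)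
    {χ : MulChar (ZMod d.natAbs) ℤ} (hχ : ∀ a : ZMod d.natAbs, χ a = J((a.val : ℤ) | d.natAbs))
    (hq : (χ.ringHomComp (Int.castRingHom ℂ)).IsQuadratic)
    (hprim : DirichletCharacter.IsPrimitive (χ.ringHomComp (Int.castRingHom ℂ)))
    (hN : W.conductorNorm ℤ ∣ A.conductorNorm ℤ) (hm : d.natAbs ^ 2 ∣ A.conductorNorm ℤ) :
    fA = charTwist (A.conductorNorm ℤ) hN hm hq fW := by
  refine eq_of_forall_cuspCoeff_eq_gamma0 fun n ↦ ?_
  rw [cuspCoeff_charTwist (A.conductorNorm ℤ) hN hm hq hprim fW n, hfA.2 n, hfW.2 n,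
    LFunction_twist_apply_addv W hd4 hadd hA n, Int.cast_mul, MulChar.ringHomComp_apply, mulChar_jacobi_apply_natCast hχ,
    eq_intCast]

omit [A.IsElliptic] in
/-- **Birch's lemma for `(f_W, f_A)` WITH the period constant** (`A` a model of `W^{(d)}`, `d > 0`, additive at the places over `d`):
`[x]⁺_{f_A} = c · Σ_b χ_d(b) [x + b/d]⁺_{f_W}` and `c²·d·(Ω⁺_{f_A})² = (Ω⁺_{f_W})²`. [cite: MazurTateTeitelbaum1986Invent, §I.8] [cite: Shimura1971, Prop. 3.64] -/
theorem exists_ratPlusSymbol_twist_eq_sum_and_sq_addv (hd : 0 < d) (hd4 : d % 4 = 1) (hsq : Squarefree d)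
    (hadd : ∀ v : HeightOneSpectrum (𝓞 ℚ), ((primesEquiv v : ℕ) : ℤ) ∣ d →
      5 ≤ (primesEquiv v : ℕ) ∧ A.HasAdditiveReductionAt v)
    {C : VariableChange ℚ} (hA : C • W.quadraticTwist (d : ℚ) = A) (hfW : IsNewformOf W fW) (hfA : IsNewformOf A fA)
    {χ : MulChar (ZMod d.natAbs) ℤ} (hχ : ∀ a : ZMod d.natAbs, χ a = J((a.val : ℤ) | d.natAbs)) :
    ∃ c : ℚ, (∀ x : ℚ, ratPlusSymbol fA x =
        c * ∑ b : ZMod d.natAbs, (χ.ringHomComp (Int.castRingHom ℚ)) b * ratPlusSymbol fW (x + (b.val : ℚ) / d.natAbs)) ∧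
      ((∃ x : ℚ, ratPlusSymbol fA x ≠ 0) → (c : ℝ) ^ 2 * (d : ℝ) * plusPeriod fA ^ 2 = plusPeriod fW ^ 2) := by
  have hmd : (d.natAbs : ℤ) = d := Int.natAbs_of_nonneg hd.le
  have hodd : Odd d.natAbs := Int.natAbs_odd.mpr (Int.odd_iff.mpr (by omega))
  have hsq' : Squarefree d.natAbs := Int.squarefree_natAbs.mpr hsq
  have hm4 : d.natAbs % 4 = 1 := by omega
  obtain ⟨hq, hprim⟩ := mulChar_jacobi_complex_isQuadratic_isPrimitive hχ hodd hsq'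
  have heven : DirichletCharacter.Even (χ.ringHomComp (Int.castRingHom ℂ)) := by
    show (χ.ringHomComp (Int.castRingHom ℂ)) (-1) = 1
    rw [MulChar.ringHomComp_apply, mulChar_jacobi_apply_neg_one hχ hm4, map_one]
  have hg2 := gaussSum_jacobi_sq_eq hd hd4 hsq hχ
  obtain ⟨hN, hm, -⟩ := conductorNorm_twist_dvd_addv W hd4 hsq hadd hA
  have hFA := isNewformOf_twist_eq_charTwist_addv W hd4 hadd hA hfW hfA hχ hq hprim hN hm
  subst hFA
  obtain ⟨c, hc, hper⟩ := exists_rat_forall_ratPlusSymbol_charTwist_eq (A.conductorNorm ℤ) hN hm hq heven hprim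
    hfW.1 hfW.coeffField_eq_bot hfA.1 hfA.coeffField_eq_bot (fun u ↦ J((u.val : ℤ) | d.natAbs))
    (fun u ↦ by rw [MulChar.ringHomComp_apply, hχ, eq_intCast])
  have hsum : ∀ x : ℚ, ∑ b : ZMod d.natAbs, (χ.ringHomComp (Int.castRingHom ℚ)) b *
      ratPlusSymbol fW (x + (b.val : ℚ) / d.natAbs) =
      ∑ u : ZMod d.natAbs, (J((u.val : ℤ) | d.natAbs) : ℚ) * ratPlusSymbol fW (x + twistShift u) := by
    intro x
    refine Finset.sum_congr rfl fun b _ ↦ ?_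
    rw [MulChar.ringHomComp_apply, hχ, eq_intCast]
    rfl
  refine ⟨c, fun x ↦ by rw [hc x, hsum x], fun ⟨x, hx⟩ ↦ ?_⟩
  have hS : ∃ r : ℚ, ∑ u : ZMod d.natAbs, (J((u.val : ℤ) | d.natAbs) : ℚ) * ratPlusSymbol fW (r + twistShift u) ≠ 0 := by
    refine ⟨x, fun h0 ↦ hx ?_⟩
    rw [hc x, h0, mul_zero]
  have hP := hper hS
  have hsqP := congrArg (fun z : ℂ ↦ z ^ 2) hP
  rw [mul_pow, mul_pow, hg2] at hsqP
  have hdZ : ((d.natAbs : ℤ) : ℂ) = (d : ℂ) := congrArg (Int.cast : ℤ → ℂ) hmd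
  have hdC : ((d.natAbs : ℕ) : ℂ) = (d : ℂ) := by rw [← hdZ, Int.cast_natCast]
  rw [hdC] at hsqP
  apply Complex.ofReal_injective
  push_cast
  linear_combination hsqP

/-! ## §4 The unit root of the twist and the transform identity -/

omit [NeZero (W.conductorNorm ℤ)] [NeZero (A.conductorNorm ℤ)] [NeZero d.natAbs] in
/-- **`A` is good ORDINARY at `2` with unit root `α_A = (2 / |d|)·α_W`** (`d` odd). [cite: MazurTateTeitelbaum1986Invent, §I.11 (allowable root)] -/
theorem isOrdinaryAt_twist_and_unitRoot_eq_addv [A.IsGloballyMinimal] (hd4 : d % 4 = 1)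
    (hadd : ∀ v : HeightOneSpectrum (𝓞 ℚ), ((primesEquiv v : ℕ) : ℤ) ∣ d →
      5 ≤ (primesEquiv v : ℕ) ∧ A.HasAdditiveReductionAt v)
    {C : VariableChange ℚ} (hA : C • W.quadraticTwist (d : ℚ) = A) (hord : IsOrdinaryAt W 2) :
    IsOrdinaryAt A 2 ∧ unitRoot A 2 = (J((2 : ℤ) | d.natAbs) : ℤ_[2]) * unitRoot W 2 := by
  have hd0 : d ≠ 0 := by omega
  have hdq : (d : ℚ) ≠ 0 := by exact_mod_cast hd0
  have h2d : ¬ ((2 : ℕ) : ℤ) ∣ d := by intro h; omega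
  haveI := W.isElliptic_quadraticTwist hdq
  -- `A` is good at `2` (`f_2(A) = f_2(W) = 0`) with `a_2(A) = χ(2) a_2(W)`
  have hpN : ¬ 2 ∣ W.conductorNorm ℤ := fun h ↦ (W.dvd_conductorNorm_iff_not_hasGoodReductionAtPrime 2).mp h hord.1
  set v2 : HeightOneSpectrum ℤ := (primesEquiv (R := ℤ)).symm ⟨2, Nat.prime_two⟩ with hv2
  have hgen2 : natGenerator v2 = 2 :=
    congrArg (fun q : Nat.Primes ↦ (q : ℕ)) ((primesEquiv (R := ℤ)).apply_symm_apply ⟨2, Nat.prime_two⟩)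
  have hfac := W.factorization_conductorNorm_quadraticTwist_eq_of_not_dvd hd4 v2 (by rw [hgen2]; exact h2d)
  rw [hgen2] at hfac
  have hNA : A.conductorNorm ℤ = (W.quadraticTwist (d : ℚ)).conductorNorm ℤ := by
    rw [← hA]; exact WeierstrassCurve.conductorNorm_smul ℤ _ C
  have hpNA : ¬ 2 ∣ A.conductorNorm ℤ := by
    intro h
    rw [hNA] at h
    have hpos : 0 < ((W.quadraticTwist (d : ℚ)).conductorNorm ℤ).factorization 2 :=
      Nat.Prime.factorization_pos_of_dvd Nat.prime_two ((W.quadraticTwist (d : ℚ)).conductorNorm_pos_holds).ne' h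
    rw [hfac] at hpos
    exact hpN (Nat.dvd_of_factorization_pos (Nat.pos_iff_ne_zero.mp hpos))
  have hgoodA : A.HasGoodReductionAtPrime 2 := by
    by_contra h
    exact hpNA ((A.dvd_conductorNorm_iff_not_hasGoodReductionAtPrime 2).mpr h)
  have haA : A.frobeniusTrace 2 = J((2 : ℤ) | d.natAbs) * W.frobeniusTrace 2 := by
    have h := LFunction_twist_apply_addv W hd4 hadd hA 2
    rwa [LFunction_apply_prime_eq_frobeniusTrace A 2 hgoodA, LFunction_apply_prime_eq_frobeniusTrace W 2 hord.1] at h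
  set s : ℤ := J((2 : ℤ) | d.natAbs) with hs
  have hpm : ¬ 2 ∣ d.natAbs := fun h ↦ h2d (Int.natCast_dvd.mpr h)
  have hs2 : s ^ 2 = 1 :=
    jacobiSym.sq_one (by
      rw [show (2 : ℤ) = ((2 : ℕ) : ℤ) by rfl, Int.gcd_natCast_natCast]
      exact (Nat.Prime.coprime_iff_not_dvd Nat.prime_two).mpr hpm)
  have hordA : IsOrdinaryAt A 2 := by
    refine ⟨hgoodA, fun h ↦ hord.2 ?_⟩
    rw [haA] at h
    have h' := h.mul_left s
    rwa [← mul_assoc, ← sq, hs2, one_mul] at h'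
  refine ⟨hordA, ?_⟩
  have hEU := existsUnique_unitRoot A 2 hordA
  have hspecA := unitRoot_spec_holds A 2 hordA
  have hspecW := unitRoot_spec_holds W 2 hord
  have hs2' : (s : ℤ_[2]) ^ 2 = 1 := by exact_mod_cast hs2
  have hβ : ((s : ℤ_[2]) * unitRoot W 2) ^ 2 - (A.frobeniusTrace 2 : ℤ_[2]) * ((s : ℤ_[2]) * unitRoot W 2) + 2 = 0 ∧
      IsUnit ((s : ℤ_[2]) * unitRoot W 2) := by
    refine ⟨?_, ?_⟩
    · rw [haA]
      push_cast
      linear_combination (unitRoot W 2 ^ 2 - (W.frobeniusTrace 2 : ℤ_[2]) * unitRoot W 2) * hs2' + hspecW.1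
    · exact (isUnit_iff_exists_inv.mpr ⟨(s : ℤ_[2]), by rw [← sq, hs2']⟩).mul hspecW.2
  have := hEU.unique hspecA hβ
  exact_mod_cast this

/-- **The transform identity `L₂(f_A, α_A) = C(c)·(1+T)^{−f_d}·L₂(f_W, d, α_W, χ_d)`, `c ≠ 0`, `c²·d·(Ω⁺_{f_A})² = (Ω⁺_{f_W})²**, `A` additive at the
places over `d`, `W` good ordinary at `2`. [cite: MazurTateTeitelbaum1986Invent, §I.8 and §I.11–I.13] [cite: Matsuno2000, §2 (p. 84)] -/
theorem exists_padicLFunction_twist_eq_C_mul_padicLFunctionTame_and_sq_addv [A.IsGloballyMinimal] (hd : 0 < d) (hd4 : d % 4 = 1)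
    (hsq : Squarefree d)
    (hadd : ∀ v : HeightOneSpectrum (𝓞 ℚ), ((primesEquiv v : ℕ) : ℤ) ∣ d →
      5 ≤ (primesEquiv v : ℕ) ∧ A.HasAdditiveReductionAt v)
    {C : VariableChange ℚ} (hA : C • W.quadraticTwist (d : ℚ) = A) (hfW : IsNewformOf W fW) (hfA : IsNewformOf A fA)
    (hord : IsOrdinaryAt W 2)
    {χ : MulChar (ZMod d.natAbs) ℤ} (hχ : ∀ a : ZMod d.natAbs, χ a = J((a.val : ℤ) | d.natAbs)) :
    ∃ c : ℚ, c ≠ 0 ∧ padicLFunction fA (unitRoot A 2 : ℚ_[2]) =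
      PowerSeries.C (c : ℚ_[2]) * PowerSeries.binomialSeries ℚ_[2] (-frobeniusExponent 2 (d.natAbs : ℤ_[2])) *
        padicLFunctionTame fW d.natAbs (unitRoot W 2 : ℚ_[2])
          ((χ.ringHomComp (Int.castRingHom ℚ)).ringHomComp (Rat.castHom ℚ_[2])) ∧
      (c : ℝ) ^ 2 * (d : ℝ) * plusPeriod fA ^ 2 = plusPeriod fW ^ 2 := by
  obtain ⟨c, hB, hper⟩ := exists_ratPlusSymbol_twist_eq_sum_and_sq_addv W hd hd4 hsq hadd hA hfW hfA hχ
  have hxA : ∃ x : ℚ, ratPlusSymbol fA x ≠ 0 := exists_ratPlusSymbol_ne_zero hfA.1 hfA.coeffField_eq_bot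
  have hc0 : c ≠ 0 := by
    rintro rfl
    obtain ⟨x, hx⟩ := hxA
    exact hx (by rw [hB x, zero_mul])
  have hd2 : ¬ ((2 : ℕ) : ℤ) ∣ d := by intro h; omega
  obtain ⟨hordA, hαA⟩ := isOrdinaryAt_twist_and_unitRoot_eq_addv W hd4 hadd hA hord
  obtain ⟨hαeq, hαu, -⟩ := unitRoot_coe_spec (W := W) hord
  have hpN : ¬ 2 ∣ W.conductorNorm ℤ := not_dvd_level_of_isNewformOf hfW hord.1
  have hpm : ¬ 2 ∣ d.natAbs := fun h ↦ hd2 (Int.natCast_dvd.mpr h)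
  have hmp : d.natAbs.Coprime 2 := Nat.coprime_comm.mp ((Nat.Prime.coprime_iff_not_dvd Nat.prime_two).mpr hpm)
  have hap : cuspCoeff fW 2 = ((W.frobeniusTrace 2 : ℤ) : ℂ) :=
    cuspCoeff_eq_frobeniusTrace_of_isNewformOf_holds hfW hord.1
  have hχp : (χ.ringHomComp (Int.castRingHom ℚ)) (2 : ZMod d.natAbs) ^ 2 = 1 := by
    have h := mulChar_jacobi_apply_natCast_sq hχ 2 hmp.symm
    rw [MulChar.ringHomComp_apply, ← map_pow]
    have h' : χ ((2 : ℕ) : ZMod d.natAbs) ^ 2 = 1 := h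
    rw [Nat.cast_ofNat] at h'
    rw [h', map_one]
  have key := padicLFunction_twist_eq_of_birch (p := 2) fW fA hfW.1 hfW.coeffField_eq_bot hpN hmp hap hαeq hαu
    (χ.ringHomComp (Int.castRingHom ℚ)) hχp hB
  have hαA' : (unitRoot A 2 : ℚ_[2]) =
      (((χ.ringHomComp (Int.castRingHom ℚ)) (2 : ZMod d.natAbs) : ℚ) : ℚ_[2]) * (unitRoot W 2 : ℚ_[2]) := by
    have h2 := mulChar_jacobi_apply_natCast hχ 2
    rw [Nat.cast_ofNat] at h2
    rw [hαA, MulChar.ringHomComp_apply, h2, eq_intCast]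
    push_cast
    rfl
  exact ⟨c, hc0, by rw [hαA']; exact key, hper hxA⟩

end Pair

end Summit.BirchSwinnertonDyer.BirchSwinnertonDyer.Theorems.AlignedTransportAtTwoBothAddBirch

end
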